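import Mathlib
import HarnessLib
import Summits.Ventures.LatticeQCDFlow.Scoring.KishESSConsistency
import Summits.Ventures.LatticeQCDFlow.Scoring.AllPairsAcceptanceRatioConsistency

/-!
# The whole printed card at `ε = 0`: along ONE growing proposal stream the three printed columns —
# acceptance ratio, Kish ESS fraction, self-normalised observable — converge almost surely and
# SIMULTANEOUSLY to `acc(p, q)`, `ESS`, `E_p O`; two codes' observable columns agree in the limit

HONEST FRAMING: exact (Metropolis-corrected) sampling algorithms for lattice gauge theory;
figures of merit are autocorrelation/cost numbers at stated couplings and volumes; no
continuum-physics claim.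

Venture `LatticeQCDFlow` (cell pub-lqcd), topic `Scoring`; FANOUT row 4 (`s0-u1-b`, rung S0-B:
two independent codes compared column by column).  The `ε = 0` companion of row 4's
`Scoring/FlowCardMedianOfBlocks` (the three columns of one run certified simultaneously at
`1 − 3e^{−R/8}` under moment inputs): here NO moment input — the columns of one independent
proposal stream `y₀, y₁, …` (laws `ν = q dμ`) with UNNORMALISED weights `w̃ = c·p/q`, `c > 0`,

  acceptance ratio `Rₙ = (Σ_{i ≠ j < n} min(w̃ᵢ, w̃ⱼ)/(n(n − 1))) / (Σ_{j<n} w̃ⱼ/n)`,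
  Kish fraction    `Kₙ = (Σ_{i<n} w̃ᵢ)²/(n Σ_{i<n} w̃ᵢ²)`,
  observable       `Sₙ = Σ_{i<n} w̃ᵢ O(yᵢ) / Σ_{i<n} w̃ᵢ`,

converge almost surely, simultaneously, to `acc(p, q) = ∫∫ min(p(a)q(b), p(b)q(a)) dμ dμ`,
`(∫ p²/q dμ)⁻¹` (`= 1/M₂ = ESS`, and `= 0` exactly when `p²/q ∉ L¹(μ)`, Lean's convention
matching the population value) and `E_p O = ∫ p·O dμ`, the inputs being `p ≥ 0`, `∫ p = 1`,
`q > 0`, `∫ q < ∞`, `p·O ∈ L¹(μ)` and nothing else (previous files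
`Scoring/AllPairsAcceptanceRatioConsistency`, `…/KishESSConsistency`,
`…/SelfNormalisedReweightingConsistency`, imported).  For TWO codes `A`, `B` (models `q_A`, `q_B`,
one target `p`), each read along its own stream on its own probability space, the observable
columns agree in the limit (`Sₙ^A − Sₙ^B → 0` for almost every pair of runs) while the acceptance
and ESS columns converge to their own model constants — the agreement table of rung S0-B at
`ε = 0`.  NEW WORK of the cell (elementary); no definition is introduced; nothing is cited as a
fact.

## Content

* **`flowCard_tendsto_ae`** — the three columns of one stream, almost surely, simultaneously;
* **`flowCard_AB_observable_agree_ae`** — two codes on their own spaces: for `P_A`-a.e. run of `A`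
  and `P_B`-a.e. run of `B`, `Sₙ^A − Sₙ^B → 0`, `Rₙ^A → acc(p, q_A)`, `Rₙ^B → acc(p, q_B)`.

NOT CLAIMED: any rate or finite-`n` radius (row 4's median-of-blocks files); the chain-side
(`τ_int`) column; any number of ours re-scored.
-/

noncomputable section

namespace Summit.Ventures.LatticeQCDFlow.Scoring.CardConsistency

open MeasureTheory ProbabilityTheory Finset Real Filter
open scoped Topology Function

section Card

variable {Ω : Type*} [MeasurableSpace Ω] {P : Measure Ω} [IsProbabilityMeasure P]
variable {X : Type*} [MeasurableSpace X] {μ : Measure X} [SFinite μ] {p q O : X → ℝ}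
variable {y : ℕ → Ω → X}

/-- **THE PRINTED CARD OF ONE PROPOSAL STREAM IS STRONGLY CONSISTENT, ALL COLUMNS AT ONCE.**
One independent proposal stream `yᵢ` (laws `μ.withDensity q`); `p ≥ 0` measurable, integrable,
`∫ p dμ = 1`; `q > 0` measurable, integrable; `O` measurable with `p·O ∈ L¹(μ)`; weights printed
with ANY normalisation `w̃ = c·p/q`, `c > 0`.  Then almost surely, simultaneously: the printed
acceptance ratio `Rₙ → acc(p, q)`, the printed Kish fraction `Kₙ → (∫ p²/q dμ)⁻¹` (the population
ESS, `0` when `p²/q ∉ L¹(μ)`), and the printed observable `Sₙ → ∫ p·O dμ`. [ours] -/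
theorem flowCard_tendsto_ae (hym : ∀ j, Measurable (y j)) (hind : iIndepFun y P)
    (hlaw : ∀ j, Measure.map (y j) P = μ.withDensity fun z => ENNReal.ofReal (q z))
    (hp0 : ∀ z, 0 ≤ p z) (hpm : Measurable p) (hpi : Integrable p μ) (hp1 : ∫ z, p z ∂μ = 1)
    (hq0 : ∀ z, 0 < q z) (hqm : Measurable q) (hqi : Integrable q μ) (hOm : Measurable O)
    (hpO : Integrable (fun z => p z * O z) μ) {wt : X → ℝ} {c : ℝ} (hc : 0 < c)
    (hwt : ∀ z, wt z = c * (p z / q z)) :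
    ∀ᵐ ω ∂P,
      Tendsto (fun n : ℕ =>
          ((∑ z ∈ (univ : Finset (Fin n)).offDiag, min (wt (y z.1 ω)) (wt (y z.2 ω)))
              / (n * (n - 1) : ℝ))
            / ((∑ j : Fin n, wt (y j ω)) / n))
        atTop (𝓝 (∫ a, ∫ b, min (p a * q b) (p b * q a) ∂μ ∂μ))
      ∧ Tendsto (fun n : ℕ => kishESS (range n) (fun i => wt (y i ω)) / n) atTop
          (𝓝 (∫ z, p z ^ 2 / q z ∂μ)⁻¹)
      ∧ Tendsto (fun n : ℕ =>
          (∑ i ∈ range n, wt (y i ω) * O (y i ω)) / (∑ i ∈ range n, wt (y i ω))) atTop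
          (𝓝 (∫ z, p z * O z ∂μ)) := by
  filter_upwards [printedAcceptance_tendsto_ae hym hind hlaw hp0 hpm hpi hp1 hq0 hqm hqi hc hwt,
    kishFrac_tendsto_inv_ae hym hind hlaw hpm hpi hp1 hq0 hqm hc.ne' hwt,
    selfNormReweighting_tendsto_ae hym hind hlaw hpm hpi hp1 hq0 hqm hOm hpO hc.ne' hwt]
    with ω h1 h2 h3
  exact ⟨h1, h2, h3⟩

/-- **TWO CODES, THE AGREEMENT TABLE AT `ε = 0`.**  Codes `A` and `B` propose from models `q_A`,
`q_B > 0` (measurable, integrable) for ONE normalised target `p ≥ 0`, each along its own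
independent stream on its own probability space, printing weights with their own normalisations
`c_A, c_B > 0`; `O` measurable with `p·O ∈ L¹(μ)`.  Then for `P_A`-almost every run of `A` and
`P_B`-almost every run of `B`: the observable columns AGREE in the limit, `Sₙ^A − Sₙ^B → 0`, while
the acceptance columns converge to their own constants `acc(p, q_A)`, `acc(p, q_B)`. [ours] -/
theorem flowCard_AB_observable_agree_ae {Ω' : Type*} [MeasurableSpace Ω'] {P' : Measure Ω'}
    [IsProbabilityMeasure P'] {q' : X → ℝ} {y' : ℕ → Ω' → X}
    (hym : ∀ j, Measurable (y j)) (hind : iIndepFun y P)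
    (hlaw : ∀ j, Measure.map (y j) P = μ.withDensity fun z => ENNReal.ofReal (q z))
    (hym' : ∀ j, Measurable (y' j)) (hind' : iIndepFun y' P')
    (hlaw' : ∀ j, Measure.map (y' j) P' = μ.withDensity fun z => ENNReal.ofReal (q' z))
    (hp0 : ∀ z, 0 ≤ p z) (hpm : Measurable p) (hpi : Integrable p μ) (hp1 : ∫ z, p z ∂μ = 1)
    (hq0 : ∀ z, 0 < q z) (hqm : Measurable q) (hqi : Integrable q μ)
    (hq0' : ∀ z, 0 < q' z) (hqm' : Measurable q') (hqi' : Integrable q' μ) (hOm : Measurable O)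
    (hpO : Integrable (fun z => p z * O z) μ) {wt wt' : X → ℝ} {c c' : ℝ} (hc : 0 < c)
    (hwt : ∀ z, wt z = c * (p z / q z)) (hc' : 0 < c') (hwt' : ∀ z, wt' z = c' * (p z / q' z)) :
    ∀ᵐ ω ∂P, ∀ᵐ ω' ∂P',
      Tendsto (fun n : ℕ =>
          (∑ i ∈ range n, wt (y i ω) * O (y i ω)) / (∑ i ∈ range n, wt (y i ω))
            - (∑ i ∈ range n, wt' (y' i ω') * O (y' i ω')) / (∑ i ∈ range n, wt' (y' i ω')))
        atTop (𝓝 0)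
      ∧ Tendsto (fun n : ℕ =>
          ((∑ z ∈ (univ : Finset (Fin n)).offDiag, min (wt (y z.1 ω)) (wt (y z.2 ω)))
              / (n * (n - 1) : ℝ))
            / ((∑ j : Fin n, wt (y j ω)) / n))
        atTop (𝓝 (∫ a, ∫ b, min (p a * q b) (p b * q a) ∂μ ∂μ))
      ∧ Tendsto (fun n : ℕ =>
          ((∑ z ∈ (univ : Finset (Fin n)).offDiag, min (wt' (y' z.1 ω')) (wt' (y' z.2 ω')))
              / (n * (n - 1) : ℝ))
            / ((∑ j : Fin n, wt' (y' j ω')) / n))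
        atTop (𝓝 (∫ a, ∫ b, min (p a * q' b) (p b * q' a) ∂μ ∂μ)) := by
  filter_upwards [printedAcceptance_tendsto_ae hym hind hlaw hp0 hpm hpi hp1 hq0 hqm hqi hc hwt,
    selfNormReweighting_tendsto_ae hym hind hlaw hpm hpi hp1 hq0 hqm hOm hpO hc.ne' hwt]
    with ω hR hS
  filter_upwards [printedAcceptance_tendsto_ae hym' hind' hlaw' hp0 hpm hpi hp1 hq0' hqm' hqi' hc'
      hwt', selfNormReweighting_tendsto_ae hym' hind' hlaw' hpm hpi hp1 hq0' hqm' hOm hpO hc'.ne'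
      hwt'] with ω' hR' hS'
  refine ⟨?_, hR, hR'⟩
  have h := hS.sub hS'
  rw [sub_self] at h
  exact h

end Card

end Summit.Ventures.LatticeQCDFlow.Scoring.CardConsistency

end
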